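import Summits.AtomisticToContinuum.FouriersLaw.Theorems.BondHeatUncertaintyExtensiveSnapshotIrreversibilityEnergyWindow

/-!
# Crux `ExtensiveSnapshotIrreversibility` (stmt-AtomisticToContinuum-9121), fixed-`N` half `K_fix`:
the energy-window statement `(W)` for the pinned chain implies `K_fix` verbatim, and the regularity
atoms of record `(R)` imply `(W)`

Part 3/4 of the energy-window reduction (imports `…EnergyWindow`, the abstract seam).  Here the
seam is specialised to the steady-state family `μ_δ = μ_{N,T+δ/2,T−δ/2}` of `pinnedChain ω₂ lam β γ`,
`μ₀ = μ_T` the Gibbs state (flip-invariant, `Negative.gibbsMeasure_map_flip`), `W = H` the Hamiltonian: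

* `SnapshotKLUpperExpansion` — `K_fix`, the text of the conclusion of
  `ClausiusBudget.stub_snapshotKLUpper_of_density` (= hypothesis `hE` of the crux work-file split
  `ExtensiveSnapshotIrreversibility_of_subs`), restated VERBATIM (that module is not built on the farm);
* `EnergyWindowControl` — `(W)`: (W0) `μ_δ = μ_T · e^{φ_δ}` for `0 < |δ| < δ₀`; (T1) uniform
  exponential moment `∫ e^{θH} dμ_δ ≤ C₁`; (T2o) crude odd bound `|φ_δ − φ_δ∘Θ| ≤ C₂(1 + H)^k`;
  (B1w) window lower bound `e^{φ_δ} ≥ 1 − C₃|δ|(1 + H)^m e^{aH}`, `12a < θ`; (B2) an `L²(μ_T)`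
  function `g₀` with `(e^{φ_δ} − 1)/δ ∈ L²(μ_T)` and `∫ ((e^{φ_δ} − 1)/δ − g₀)² dμ_T → 0`
  (quadratic-mean differentiability of the density ratio at `δ = 0`);
* `snapshotKLUpperExpansion_of_energyWindow : EnergyWindowControl → SnapshotKLUpperExpansion`
  (the response density `h` of the item's interface equals `g₀` a.e. by uniqueness of weak
  derivatives, `OddLogDensity.ae_eq_of_tendsto_testFunction`; then `klDiv_flip_le_of_energyWindow`);
* `LogDensityRegularity` — `(R)`, the text of the hypothesis of

The dictionary `(R) ⟹ (W)` from the regularity atoms of record is part 4/4 (`…EnergyWindowChain`).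
No new objects; two `Prop` abbreviations of existing statement texts.
References: see `…EnergyWindowTree`.
-/

noncomputable section

namespace Summit.AtomisticToContinuum.FouriersLaw.Theorems.ExtensiveSnapshotIrreversibility.EnergyWindow

open MeasureTheory Filter Topology InformationTheory Real
open scoped ENNReal NNReal
open Literature.MathematicalPhysics.KineticTheory.HeatConduction
-- landing revision (as in the landed `…EnergyWindowTree` / `…EnergyWindow`, reviewers of p847350 / p847405): the seat namespace `Tree`
-- of re-proved tree lemmas is gone; the originals are opened instead.
open Summit.AtomisticToContinuum.FouriersLaw.Theorems.ExtensiveSnapshotIrreversibility.Negative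
open Summit.AtomisticToContinuum.FouriersLaw.Theorems.ExtensiveSnapshotIrreversibility.ClausiusBudget.OddLogDensity

variable {N : ℕ}

/-! ## 1. The statements -/

/-- **`K_fix` = `SnapshotKLUpperExpansion`** (the fixed-`N` half of crux (K)
`ExtensiveSnapshotIrreversibility`), verbatim the conclusion of
`ClausiusBudget.stub_snapshotKLUpper_of_density`: under weak-NESS uniqueness, along every
steady-state family of the pinned chain, for `T > 0`, `N ≥ 2` and every `L²` linear-response density
`h` at `δ = 0` (weak `δ`-derivative tested on `C_c^∞` observables and on the bond currents), for every
`K > ½ ∫ (h − h∘Θ)² dμ_{N,T,T}`: eventually in `δ ≠ 0`,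
`KL(μ_{N,T+δ/2,T−δ/2} ‖ Θ_* μ_{N,T+δ/2,T−δ/2}) ≤ K δ²`. [route statement · this cell; NOT a literature fact] -/
def SnapshotKLUpperExpansion : Prop :=
  ∀ ω₂ lam β γ : ℝ, 0 < ω₂ → 0 < lam → 0 < β → 0 < γ →
    (∀ (N : ℕ) (T_L T_R : ℝ), 0 < T_L → 0 < T_R → ∀ μ ν : Measure (PhaseSpace N),
      (pinnedChain ω₂ lam β γ).IsSteadyState N T_L T_R μ →
      (pinnedChain ω₂ lam β γ).IsSteadyState N T_L T_R ν → μ = ν) →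
    ∀ μ : (N : ℕ) → ℝ → ℝ → Measure (PhaseSpace N),
      (∀ (N : ℕ) (T_L T_R : ℝ), 0 < T_L → 0 < T_R →
        (pinnedChain ω₂ lam β γ).IsSteadyState N T_L T_R (μ N T_L T_R)) →
      ∀ T : ℝ, 0 < T → ∀ N : ℕ, 2 ≤ N → ∀ h : PhaseSpace N → ℝ,
        (MemLp h 2 (μ N T T) ∧
          (∀ F : PhaseSpace N → ℝ, ContDiff ℝ ((⊤ : ℕ∞) : WithTop ℕ∞) F → HasCompactSupport F →
            Tendsto (fun δ : ℝ => ((∫ x, F x ∂(μ N (T + δ / 2) (T - δ / 2))) - ∫ x, F x ∂(μ N T T)) / δ)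
              (𝓝[≠] (0 : ℝ)) (𝓝 (∫ x, F x * h x ∂(μ N T T)))) ∧
          (∀ i : Fin N, Tendsto (fun δ : ℝ =>
              ((∫ x, (pinnedChain ω₂ lam β γ).bondCurrent N i x ∂(μ N (T + δ / 2) (T - δ / 2))) -
                ∫ x, (pinnedChain ω₂ lam β γ).bondCurrent N i x ∂(μ N T T)) / δ)
              (𝓝[≠] (0 : ℝ)) (𝓝 (∫ x, (pinnedChain ω₂ lam β γ).bondCurrent N i x * h x ∂(μ N T T))))) →
        ∀ K : ℝ, (1 / 2 : ℝ) * ∫ x, (h x - h (x.1, -x.2)) ^ 2 ∂(μ N T T) < K →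
          ∀ᶠ δ in 𝓝[≠] (0 : ℝ),
            klDiv (μ N (T + δ / 2) (T - δ / 2))
                (Measure.map (fun x : PhaseSpace N => (x.1, -x.2)) (μ N (T + δ / 2) (T - δ / 2)))
              ≤ ENNReal.ofReal (K * δ ^ 2)

/-- **`(W)` = `EnergyWindowControl`**: along every steady-state family of the pinned chain (under
weak-NESS uniqueness), for `T > 0` and `N ≥ 2` there are `δ₀ > 0`, `θ > 0`, `a` with `12a < θ`,
constants `C₁ C₂ C₃`, exponents `k m`, measurable log-density ratios `φ_δ` and an `L²(μ_T)` function
`g₀` with: (W0) `μ_{N,T+δ/2,T−δ/2} = μ_T · e^{φ_δ}` for `0 < |δ| < δ₀` (`μ_T` the Gibbs state);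
(T1) `e^{θH} ∈ L¹(μ_{N,T+δ/2,T−δ/2})` with `∫ e^{θH} dμ_{N,T+δ/2,T−δ/2} ≤ C₁`; (T2o) the CRUDE,
`δ`-uniform odd bound `|φ_δ − φ_δ∘Θ| ≤ C₂ (1 + H)^k`; (B1w) the one-sided window lower bound
`e^{φ_δ} ≥ 1 − C₃|δ|(1 + H)^m e^{aH}`; (B2) `(e^{φ_δ} − 1)/δ ∈ L²(μ_T)` and
`∫ ((e^{φ_δ} − 1)/δ − g₀)² dμ_T → 0` as `δ → 0`, `δ ≠ 0`. [route statement · this cell; NOT a literature fact] -/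
def EnergyWindowControl : Prop :=
  ∀ ω₂ lam β γ : ℝ, 0 < ω₂ → 0 < lam → 0 < β → 0 < γ →
    (∀ (N : ℕ) (T_L T_R : ℝ), 0 < T_L → 0 < T_R → ∀ μ ν : Measure (PhaseSpace N),
      (pinnedChain ω₂ lam β γ).IsSteadyState N T_L T_R μ →
      (pinnedChain ω₂ lam β γ).IsSteadyState N T_L T_R ν → μ = ν) →
    ∀ μ : (N : ℕ) → ℝ → ℝ → Measure (PhaseSpace N),
      (∀ (N : ℕ) (T_L T_R : ℝ), 0 < T_L → 0 < T_R →
        (pinnedChain ω₂ lam β γ).IsSteadyState N T_L T_R (μ N T_L T_R)) →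
      ∀ T : ℝ, 0 < T → ∀ N : ℕ, 2 ≤ N →
        ∃ δ₀ θ a C₁ C₂ C₃ : ℝ, ∃ k m : ℕ, 0 < δ₀ ∧ 0 < θ ∧ 12 * a < θ ∧
        ∃ φ : ℝ → PhaseSpace N → ℝ, ∃ g₀ : PhaseSpace N → ℝ,
          (∀ δ : ℝ, Measurable (φ δ)) ∧
          (∀ δ : ℝ, δ ≠ 0 → |δ| < δ₀ →
            μ N (T + δ / 2) (T - δ / 2) =
              ((pinnedChain ω₂ lam β γ).gibbsMeasure N T).withDensity
                (fun x => ENNReal.ofReal (Real.exp (φ δ x)))) ∧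
          (∀ δ : ℝ, δ ≠ 0 → |δ| < δ₀ →
            Integrable (fun x => Real.exp (θ * (pinnedChain ω₂ lam β γ).hamiltonian N x))
                (μ N (T + δ / 2) (T - δ / 2)) ∧
              ∫ x, Real.exp (θ * (pinnedChain ω₂ lam β γ).hamiltonian N x) ∂(μ N (T + δ / 2) (T - δ / 2))
                ≤ C₁) ∧
          (∀ δ : ℝ, |δ| < δ₀ → ∀ x : PhaseSpace N,
            |φ δ x - φ δ (x.1, -x.2)| ≤ C₂ * (1 + (pinnedChain ω₂ lam β γ).hamiltonian N x) ^ k) ∧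
          (∀ δ : ℝ, |δ| < δ₀ → ∀ x : PhaseSpace N,
            1 - C₃ * |δ| * (1 + (pinnedChain ω₂ lam β γ).hamiltonian N x) ^ m *
                Real.exp (a * (pinnedChain ω₂ lam β γ).hamiltonian N x) ≤ Real.exp (φ δ x)) ∧
          (MemLp g₀ 2 ((pinnedChain ω₂ lam β γ).gibbsMeasure N T) ∧
            (∀ δ : ℝ, δ ≠ 0 → |δ| < δ₀ →
              MemLp (fun x => (Real.exp (φ δ x) - 1) / δ) 2 ((pinnedChain ω₂ lam β γ).gibbsMeasure N T)) ∧
            Tendsto (fun δ : ℝ => ∫ x, ((Real.exp (φ δ x) - 1) / δ - g₀ x) ^ 2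
                ∂(pinnedChain ω₂ lam β γ).gibbsMeasure N T) (𝓝[≠] (0 : ℝ)) (𝓝 0))

/-! ## 2. Two `L²` lemmas: quadratic-mean convergence gives the weak derivative and the odd form -/

/-- **Quadratic-mean convergence gives convergence of the pairings with bounded observables**:
if `∫ (q_δ − g₀)² dμ → 0` (finite `μ`; `q_δ, g₀ ∈ L²`) and `|F| ≤ B` is measurable then
`∫ F q_δ dμ → ∫ F g₀ dμ` (`2|F e| ≤ t F² + e²/t`). [folklore] -/
theorem tendsto_integral_mul_of_tendsto_integral_sq {μ : Measure (PhaseSpace N)} [IsFiniteMeasure μ]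
    {q : ℝ → PhaseSpace N → ℝ} {g₀ F : PhaseSpace N → ℝ} {B : ℝ}
    (hF : AEStronglyMeasurable F μ) (hFB : ∀ x, |F x| ≤ B)
    (hg₀ : MemLp g₀ 2 μ) (hq : ∀ᶠ δ in 𝓝[≠] (0 : ℝ), MemLp (q δ) 2 μ)
    (hlim : Tendsto (fun δ => ∫ x, (q δ x - g₀ x) ^ 2 ∂μ) (𝓝[≠] (0 : ℝ)) (𝓝 0)) :
    Tendsto (fun δ => ∫ x, F x * q δ x ∂μ) (𝓝[≠] (0 : ℝ)) (𝓝 (∫ x, F x * g₀ x ∂μ)) := by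
  rw [Metric.tendsto_nhds]
  intro ε hε
  have hF2i : Integrable (fun x => F x ^ 2) μ := by
    refine (integrable_const (B ^ 2)).mono' (hF.pow 2) (ae_of_all _ fun x => ?_)
    rw [Real.norm_eq_abs, abs_of_nonneg (sq_nonneg _), ← sq_abs]
    exact pow_le_pow_left₀ (abs_nonneg _) (hFB x) 2
  set A : ℝ := ∫ x, F x ^ 2 ∂μ with hA
  have hA0 : 0 ≤ A := integral_nonneg fun x => sq_nonneg _
  set t : ℝ := ε / (A + 1) with ht
  have htpos : 0 < t := by rw [ht]; positivity
  have htA : t * A < ε := by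
    rw [ht, div_mul_eq_mul_div, div_lt_iff₀ (by linarith)]
    nlinarith
  have hev : ∀ᶠ δ in 𝓝[≠] (0 : ℝ), ∫ x, (q δ x - g₀ x) ^ 2 ∂μ < ε * t :=
    hlim.eventually_lt_const (by positivity)
  filter_upwards [hq, hev] with δ hqδ hδ
  have hBF : ∀ᵐ x ∂μ, ‖F x‖ ≤ B := ae_of_all _ fun x => by rw [Real.norm_eq_abs]; exact hFB x
  have hi1 : Integrable (fun x => F x * q δ x) μ := (hqδ.integrable one_le_two).bdd_mul hF hBF
  have hi0 : Integrable (fun x => F x * g₀ x) μ := (hg₀.integrable one_le_two).bdd_mul hF hBF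
  have he2 : Integrable (fun x => (q δ x - g₀ x) ^ 2) μ := (hqδ.sub hg₀).integrable_sq
  rw [Real.dist_eq, ← integral_sub hi1 hi0]
  have hpt : ∀ x, |F x * q δ x - F x * g₀ x| ≤ t / 2 * F x ^ 2 + (1 / (2 * t)) * (q δ x - g₀ x) ^ 2 :=
    fun x => by
      have h := two_mul_abs_mul_le (a := F x) (b := q δ x - g₀ x) htpos
      have e : F x * q δ x - F x * g₀ x = F x * (q δ x - g₀ x) := by ring
      rw [e]
      have e2 : t / 2 * F x ^ 2 + (1 / (2 * t)) * (q δ x - g₀ x) ^ 2 =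
          (t * F x ^ 2 + (q δ x - g₀ x) ^ 2 / t) / 2 := by ring
      rw [e2]
      linarith
  calc |∫ x, (F x * q δ x - F x * g₀ x) ∂μ| ≤ ∫ x, |F x * q δ x - F x * g₀ x| ∂μ :=
        abs_integral_le_integral_abs
    _ ≤ ∫ x, (t / 2 * F x ^ 2 + (1 / (2 * t)) * (q δ x - g₀ x) ^ 2) ∂μ :=
        integral_mono (hi1.sub hi0).abs ((hF2i.const_mul _).add (he2.const_mul _)) hpt
    _ = t / 2 * A + (1 / (2 * t)) * ∫ x, (q δ x - g₀ x) ^ 2 ∂μ := by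
        rw [integral_add (hF2i.const_mul _) (he2.const_mul _), integral_const_mul, integral_const_mul]
    _ < ε := by
        have h1 : (1 / (2 * t)) * ∫ x, (q δ x - g₀ x) ^ 2 ∂μ < ε / 2 := by
          rw [one_div, inv_mul_lt_iff₀ (by positivity)]
          linarith
        linarith

/-- **Quadratic-mean differentiability of the density ratio controls the odd quadratic form**:
for a flip-invariant finite measure `μ`, if `q_δ := (e^{φ_δ} − 1)/δ ∈ L²(μ)` eventually and
`∫ (q_δ − g₀)² dμ → 0` with `g₀ ∈ L²(μ)`, then for every `D' > ∫ (g₀ − g₀∘Θ)² dμ`, eventually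
`(e^{φ_δ} − e^{φ_δ∘Θ})² ∈ L¹(μ)` and `∫ (e^{φ_δ} − e^{φ_δ∘Θ})² dμ ≤ D' δ²`
(`e^{φ_δ} − e^{φ_δ∘Θ} = δ (q_δ − q_δ∘Θ)`, `(A + B)² ≤ (1 + t)A² + (1 + 1/t)B²`). [folklore] -/
theorem eventually_integral_oddSq_le {μ : Measure (PhaseSpace N)} [IsFiniteMeasure μ]
    (hinv : μ.map (fun x : PhaseSpace N => (x.1, -x.2)) = μ)
    {φ : ℝ → PhaseSpace N → ℝ} {g₀ : PhaseSpace N → ℝ} (hg₀ : MemLp g₀ 2 μ)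
    (hq : ∀ᶠ δ in 𝓝[≠] (0 : ℝ), MemLp (fun x => (exp (φ δ x) - 1) / δ) 2 μ)
    (hlim : Tendsto (fun δ => ∫ x, ((exp (φ δ x) - 1) / δ - g₀ x) ^ 2 ∂μ) (𝓝[≠] (0 : ℝ)) (𝓝 0)) :
    ∀ D' : ℝ, ∫ x, (g₀ x - g₀ (x.1, -x.2)) ^ 2 ∂μ < D' → ∀ᶠ δ in 𝓝[≠] (0 : ℝ),
      Integrable (fun x => (exp (φ δ x) - exp (φ δ (x.1, -x.2))) ^ 2) μ ∧
      ∫ x, (exp (φ δ x) - exp (φ δ (x.1, -x.2))) ^ 2 ∂μ ≤ D' * δ ^ 2 := by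
  intro D' hD'
  have hmp : MeasurePreserving (momentumReversal N) μ μ := ⟨(momentumReversal N).measurable, hinv⟩
  set G : ℝ := ∫ x, (g₀ x - g₀ (x.1, -x.2)) ^ 2 ∂μ with hG
  have hG0 : 0 ≤ G := integral_nonneg fun x => sq_nonneg _
  set t : ℝ := (D' - G) / (2 * (G + 1)) with ht
  have htpos : 0 < t := by rw [ht]; exact div_pos (by linarith) (by positivity)
  have htG : (1 + t) * G ≤ G + (D' - G) / 2 := by
    have h1 : G / (2 * (G + 1)) ≤ 1 / 2 := by
      rw [div_le_iff₀ (by positivity)]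
      linarith
    have e : t * G = (D' - G) * (G / (2 * (G + 1))) := by rw [ht]; ring
    have h2 : (D' - G) * (G / (2 * (G + 1))) ≤ (D' - G) * (1 / 2) :=
      mul_le_mul_of_nonneg_left h1 (by linarith)
    nlinarith [e, h2]
  set c : ℝ := (D' - G) / (2 * (4 * (1 + 1 / t))) with hc
  have hcpos : 0 < c := by rw [hc]; exact div_pos (by linarith) (by positivity)
  have hev : ∀ᶠ δ in 𝓝[≠] (0 : ℝ), ∫ x, ((exp (φ δ x) - 1) / δ - g₀ x) ^ 2 ∂μ < c :=
    hlim.eventually_lt_const hcpos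
  filter_upwards [hq, hev, self_mem_nhdsWithin] with δ hqδ hδc hδ
  -- names
  set q : PhaseSpace N → ℝ := fun x => (exp (φ δ x) - 1) / δ with hqdef
  have hqΘ : MemLp (fun x : PhaseSpace N => q (x.1, -x.2)) 2 μ := hqδ.comp_measurePreserving hmp
  have hg₀Θ : MemLp (fun x : PhaseSpace N => g₀ (x.1, -x.2)) 2 μ := hg₀.comp_measurePreserving hmp
  set e : PhaseSpace N → ℝ := fun x => q x - g₀ x with hedef
  have he : MemLp e 2 μ := hqδ.sub hg₀
  have heΘ : MemLp (fun x : PhaseSpace N => e (x.1, -x.2)) 2 μ := he.comp_measurePreserving hmp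
  have hδ' : δ ≠ 0 := hδ
  have hkey : ∀ x : PhaseSpace N, exp (φ δ x) - exp (φ δ (x.1, -x.2)) = δ * (q x - q (x.1, -x.2)) := by
    intro x
    simp only [hqdef]
    rw [← sub_div, mul_div_cancel₀ _ hδ']
    ring
  have hdiff : MemLp (fun x : PhaseSpace N => q x - q (x.1, -x.2)) 2 μ := hqδ.sub hqΘ
  have hI : Integrable (fun x : PhaseSpace N => (q x - q (x.1, -x.2)) ^ 2) μ := hdiff.integrable_sq
  have hI' : Integrable (fun x => (exp (φ δ x) - exp (φ δ (x.1, -x.2))) ^ 2) μ := by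
    have := hI.const_mul (δ ^ 2)
    refine this.congr (ae_of_all _ fun x => ?_)
    show δ ^ 2 * (q x - q (x.1, -x.2)) ^ 2 = (exp (φ δ x) - exp (φ δ (x.1, -x.2))) ^ 2
    rw [hkey x]
    ring
  refine ⟨hI', ?_⟩
  -- pointwise: (q − qΘ)² ≤ (1+t)(g₀ − g₀Θ)² + (1 + 1/t)(2e² + 2eΘ²)
  have hpt : ∀ x : PhaseSpace N, (q x - q (x.1, -x.2)) ^ 2 ≤
      (1 + t) * (g₀ x - g₀ (x.1, -x.2)) ^ 2 +
        (1 + 1 / t) * (2 * e x ^ 2 + 2 * e (x.1, -x.2) ^ 2) := by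
    intro x
    have hsplit : q x - q (x.1, -x.2) = (g₀ x - g₀ (x.1, -x.2)) + (e x - e (x.1, -x.2)) := by
      simp only [hedef]; ring
    rw [hsplit]
    refine (add_sq_le_weighted htpos).trans ?_
    have h2 : (e x - e (x.1, -x.2)) ^ 2 ≤ 2 * e x ^ 2 + 2 * e (x.1, -x.2) ^ 2 := by
      nlinarith [sq_nonneg (e x + e (x.1, -x.2))]
    have h3 : 0 ≤ 1 + 1 / t := by positivity
    nlinarith [mul_le_mul_of_nonneg_left h2 h3]
  have hIg : Integrable (fun x : PhaseSpace N => (g₀ x - g₀ (x.1, -x.2)) ^ 2) μ := (hg₀.sub hg₀Θ).integrable_sq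
  have hIe : Integrable (fun x => e x ^ 2) μ := he.integrable_sq
  have hIeΘ : Integrable (fun x : PhaseSpace N => e (x.1, -x.2) ^ 2) μ := heΘ.integrable_sq
  have hI1 : Integrable (fun x : PhaseSpace N => (1 + t) * (g₀ x - g₀ (x.1, -x.2)) ^ 2) μ :=
    hIg.const_mul _
  have hI2 : Integrable (fun x : PhaseSpace N => 2 * e x ^ 2 + 2 * e (x.1, -x.2) ^ 2) μ :=
    (hIe.const_mul 2).add (hIeΘ.const_mul 2)
  have hI3 : Integrable (fun x : PhaseSpace N => (1 + 1 / t) * (2 * e x ^ 2 + 2 * e (x.1, -x.2) ^ 2)) μ :=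
    hI2.const_mul _
  have hIrhs : Integrable (fun x : PhaseSpace N => (1 + t) * (g₀ x - g₀ (x.1, -x.2)) ^ 2 +
      (1 + 1 / t) * (2 * e x ^ 2 + 2 * e (x.1, -x.2) ^ 2)) μ := hI1.add hI3
  have heflip : ∫ x : PhaseSpace N, e (x.1, -x.2) ^ 2 ∂μ = ∫ x, e x ^ 2 ∂μ :=
    integral_comp_flip μ hinv (fun x => e x ^ 2)
  have hec : ∫ x, e x ^ 2 ∂μ < c := by simpa only [hedef, hqdef] using hδc
  have hbound : ∫ x : PhaseSpace N, (q x - q (x.1, -x.2)) ^ 2 ∂μ ≤ D' := by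
    calc ∫ x : PhaseSpace N, (q x - q (x.1, -x.2)) ^ 2 ∂μ
        ≤ ∫ x : PhaseSpace N, ((1 + t) * (g₀ x - g₀ (x.1, -x.2)) ^ 2 +
            (1 + 1 / t) * (2 * e x ^ 2 + 2 * e (x.1, -x.2) ^ 2)) ∂μ := integral_mono hI hIrhs hpt
      _ = (1 + t) * G + (1 + 1 / t) * (2 * ∫ x, e x ^ 2 ∂μ + 2 * ∫ x : PhaseSpace N, e (x.1, -x.2) ^ 2 ∂μ) := by
          have hIe2 : Integrable (fun x : PhaseSpace N => 2 * e x ^ 2) μ := hIe.const_mul 2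
          have hIeΘ2 : Integrable (fun x : PhaseSpace N => 2 * e (x.1, -x.2) ^ 2) μ := hIeΘ.const_mul 2
          rw [integral_add hI1 hI3, integral_const_mul, integral_const_mul, integral_add hIe2 hIeΘ2,
            integral_const_mul, integral_const_mul]
      _ = (1 + t) * G + 4 * (1 + 1 / t) * ∫ x, e x ^ 2 ∂μ := by rw [heflip]; ring
      _ ≤ G + (D' - G) / 2 + (D' - G) / 2 := by
          have h4 : 4 * (1 + 1 / t) * ∫ x, e x ^ 2 ∂μ ≤ (D' - G) / 2 := by
            have h0 : 0 < 4 * (1 + 1 / t) := by positivity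
            have : ∫ x, e x ^ 2 ∂μ ≤ c := hec.le
            calc 4 * (1 + 1 / t) * ∫ x, e x ^ 2 ∂μ ≤ 4 * (1 + 1 / t) * c :=
                  mul_le_mul_of_nonneg_left this h0.le
              _ = (D' - G) / 2 := by rw [hc]; field_simp
          linarith [htG, h4]
      _ = D' := by ring
  calc ∫ x, (exp (φ δ x) - exp (φ δ (x.1, -x.2))) ^ 2 ∂μ
      = ∫ x : PhaseSpace N, δ ^ 2 * (q x - q (x.1, -x.2)) ^ 2 ∂μ := by
        refine integral_congr_ae (ae_of_all _ fun x => ?_)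
        show (exp (φ δ x) - exp (φ δ (x.1, -x.2))) ^ 2 = δ ^ 2 * (q x - q (x.1, -x.2)) ^ 2
        rw [hkey x]
        ring
    _ = δ ^ 2 * ∫ x : PhaseSpace N, (q x - q (x.1, -x.2)) ^ 2 ∂μ := integral_const_mul _ _
    _ ≤ δ ^ 2 * D' := mul_le_mul_of_nonneg_left hbound (sq_nonneg δ)
    _ = D' * δ ^ 2 := by ring

/-! ## 3. `(W) ⟹ K_fix` -/

/-- **`(W) ⟹ K_fix`.**  The energy-window statement for the pinned chain implies the fixed-`N`
snapshot KL upper expansion verbatim: the item's response density `h` equals the `L²`-derivative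
`g₀` of the density ratio `μ_T`-a.e. (both are weak `δ`-derivatives of `δ ↦ μ_δ` on `C_c^∞`
tests — `tendsto_integral_mul_of_tendsto_integral_sq`, `OddLogDensity.ae_eq_of_tendsto_testFunction`), so
`½ ∫ (h − h∘Θ)² dμ_{N,T,T} = ½ ∫ (g₀ − g₀∘Θ)² dμ_T`; (B2) gives the odd quadratic form
(`eventually_integral_oddSq_le`) and `klDiv_flip_le_of_energyWindow` (with `μ₀ = μ_T`, `W = H`,
`Negative.gibbsMeasure_map_flip`) gives `KL ≤ K δ²` eventually for every `K` above it. [folklore] -/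
theorem snapshotKLUpperExpansion_of_energyWindow (hW : EnergyWindowControl) :
    SnapshotKLUpperExpansion := by
  intro ω₂ lam β γ hω₂ hlam hβ hγ hU μ hμ T hT N hN h hh K hK
  obtain ⟨δ₀, θ, a, C₁, C₂, C₃, k, m, hδ₀, hθ, ha, φ, g₀, hφm, hW0, hT1, hT2, hB1, hg₀, hq, hlim⟩ :=
    hW ω₂ lam β γ hω₂ hlam hβ hγ hU μ hμ T hT N hN
  set P := pinnedChain ω₂ lam β γ with hP
  set μT := P.gibbsMeasure N T with hμT
  haveI hprob : IsProbabilityMeasure μT :=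
    pinnedChain_isProbabilityMeasure_gibbsMeasure hω₂ hlam.le hβ.le γ N hT
  have hG : μ N T T = μT :=
    hU N T T hT hT _ _ (hμ N T T hT hT) (pinnedChain_isSteadyState_gibbsMeasure hω₂ hlam.le hβ.le γ N hT)
  have hinv : μT.map (fun x : PhaseSpace N => (x.1, -x.2)) = μT := gibbsMeasure_map_flip P N T
  have hmp : MeasurePreserving (momentumReversal N) μT μT := ⟨(momentumReversal N).measurable, hinv⟩
  have hHm : Measurable (P.hamiltonian N) := (pinnedChain_continuous_hamiltonian ω₂ lam β γ N).measurable
  have hH0 : ∀ x, 0 ≤ P.hamiltonian N x := pinnedChain_hamiltonian_nonneg hω₂.le hlam.le hβ.le γ N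
  have hHflip : ∀ x : PhaseSpace N, P.hamiltonian N (x.1, -x.2) = P.hamiltonian N x :=
    P.hamiltonian_neg_momentum N
  -- the eventual range and the tilted representation of the states
  have hev : ∀ᶠ δ in 𝓝[≠] (0 : ℝ), δ ≠ 0 ∧ |δ| < δ₀ := eventually_ne_and_abs_lt hδ₀
  have hevT : ∀ᶠ δ in 𝓝[≠] (0 : ℝ), 0 < T + δ / 2 ∧ 0 < T - δ / 2 := eventually_bath_temps_pos hT
  have hrep : ∀ δ : ℝ, δ ≠ 0 → |δ| < δ₀ → 0 < T + δ / 2 → 0 < T - δ / 2 →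
      Integrable (fun x => exp (φ δ x)) μT ∧ ∫ x, exp (φ δ x) ∂μT = 1 ∧
        μ N (T + δ / 2) (T - δ / 2) = μT.tilted (φ δ) := by
    intro δ hδ hδa h1 h2
    haveI : IsProbabilityMeasure (μ N (T + δ / 2) (T - δ / 2)) := (hμ N _ _ h1 h2).1
    exact tilted_of_withDensity_exp (hφm δ) (hW0 δ hδ hδa)
  have hZ : ∀ᶠ δ in 𝓝[≠] (0 : ℝ), Integrable (fun x => exp (φ δ x)) μT ∧ ∫ x, exp (φ δ x) ∂μT = 1 := by
    filter_upwards [hev, hevT] with δ h1 h2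
    exact ⟨(hrep δ h1.1 h1.2 h2.1 h2.2).1, (hrep δ h1.1 h1.2 h2.1 h2.2).2.1⟩
  have hT1' : ∀ᶠ δ in 𝓝[≠] (0 : ℝ),
      Integrable (fun x => exp (θ * P.hamiltonian N x) * exp (φ δ x)) μT ∧
        ∫ x, exp (θ * P.hamiltonian N x) * exp (φ δ x) ∂μT ≤ C₁ := by
    filter_upwards [hev, hevT] with δ h1 h2
    obtain ⟨hi, hz1, htilt⟩ := hrep δ h1.1 h1.2 h2.1 h2.2
    obtain ⟨hI, hle⟩ := hT1 δ h1.1 h1.2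
    rw [htilt] at hI hle
    rw [integrable_tilted_iff hi] at hI
    rw [integral_tilted] at hle
    refine ⟨hI.congr (ae_of_all _ fun x => ?_), ?_⟩
    · simp only [smul_eq_mul]
      ring
    · refine le_trans (le_of_eq (integral_congr_ae (ae_of_all _ fun x => ?_))) hle
      simp only [hz1, div_one, smul_eq_mul]
      ring
  have hT2' : ∀ᶠ δ in 𝓝[≠] (0 : ℝ), ∀ x : PhaseSpace N,
      |φ δ x - φ δ (x.1, -x.2)| ≤ C₂ * (1 + P.hamiltonian N x) ^ k := by
    filter_upwards [hev] with δ h1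
    exact hT2 δ h1.2
  have hB1' : ∀ᶠ δ in 𝓝[≠] (0 : ℝ), ∀ x : PhaseSpace N,
      1 - C₃ * |δ| * (1 + P.hamiltonian N x) ^ m * exp (a * P.hamiltonian N x) ≤ exp (φ δ x) := by
    filter_upwards [hev] with δ h1
    exact hB1 δ h1.2
  have hq' : ∀ᶠ δ in 𝓝[≠] (0 : ℝ), MemLp (fun x => (exp (φ δ x) - 1) / δ) 2 μT := by
    filter_upwards [hev] with δ h1
    exact hq δ h1.1 h1.2
  set D : ℝ := ∫ x : PhaseSpace N, (g₀ x - g₀ (x.1, -x.2)) ^ 2 ∂μT with hD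
  have hseam := klDiv_flip_le_of_energyWindow μT hinv hHm hH0 hHflip hθ ha φ hφm hZ hT1' hT2' hB1'
    (D := D) (fun D' hD' => eventually_integral_oddSq_le hinv hg₀ hq' hlim D' hD')
  -- `h = g₀` a.e.: both are weak derivatives on `C_c^∞` tests
  have hae : h =ᵐ[μT] g₀ := by
    have hh1 : Integrable h μT := by
      have hm2 : MemLp h 2 μT := by
        have := hh.1
        rwa [hG] at this
      exact hm2.integrable one_le_two
    refine ae_eq_of_tendsto_testFunction hh1 (hg₀.integrable one_le_two)
      (Q := fun F δ => ((∫ x, F x ∂(μ N (T + δ / 2) (T - δ / 2))) - ∫ x, F x ∂μT) / δ) ?_ ?_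
    · intro F hF hFc
      have h2 := hh.2.1 F hF hFc
      rw [hG] at h2
      exact h2
    · intro F hF hFc
      obtain ⟨B, hB⟩ := hF.continuous.bounded_above_of_compact_support hFc
      have hFm : AEStronglyMeasurable F μT := hF.continuous.aestronglyMeasurable
      have hFB : ∀ x, |F x| ≤ B := fun x => by rw [← Real.norm_eq_abs]; exact hB x
      have hFi : Integrable F μT := hF.continuous.integrable_of_hasCompactSupport hFc
      have hlimF := tendsto_integral_mul_of_tendsto_integral_sq (q := fun δ x => (exp (φ δ x) - 1) / δ)
        hFm hFB hg₀ hq' hlim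
      refine hlimF.congr' ?_
      filter_upwards [hev, hevT] with δ h1 h2
      obtain ⟨hi, hz1, htilt⟩ := hrep δ h1.1 h1.2 h2.1 h2.2
      have hFei : Integrable (fun x => F x * exp (φ δ x)) μT :=
        hi.bdd_mul hFm (ae_of_all _ fun x => hB x)
      have hint : ∫ x, F x ∂(μ N (T + δ / 2) (T - δ / 2)) = ∫ x, F x * exp (φ δ x) ∂μT := by
        rw [htilt, integral_tilted]
        refine integral_congr_ae (ae_of_all _ fun x => ?_)
        simp only [hz1, div_one, smul_eq_mul]
        ring
      rw [hint, ← integral_sub hFei hFi, ← integral_div]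
      refine integral_congr_ae (ae_of_all _ fun x => ?_)
      show F x * ((exp (φ δ x) - 1) / δ) = (F x * exp (φ δ x) - F x) / δ
      ring
  -- the threshold: `½ ∫ (h − h∘Θ)² dμ_{N,T,T} = D/2`
  have hDK : D / 2 < K := by
    have haeΘ : (fun x : PhaseSpace N => h (x.1, -x.2)) =ᵐ[μT] fun x => g₀ (x.1, -x.2) :=
      hmp.quasiMeasurePreserving.ae_eq_comp hae
    have hint : ∫ x, (h x - h (x.1, -x.2)) ^ 2 ∂(μ N T T) = D := by
      rw [hG, hD]
      refine integral_congr_ae ?_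
      filter_upwards [hae, haeΘ] with x hx hxΘ
      rw [hx, hxΘ]
    rw [hint] at hK
    linarith
  filter_upwards [hseam K hDK, hev, hevT] with δ hs h1 h2
  rw [(hrep δ h1.1 h1.2 h2.1 h2.2).2.2]
  exact hs

end Summit.AtomisticToContinuum.FouriersLaw.Theorems.ExtensiveSnapshotIrreversibility.EnergyWindow

end
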